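import Literature.NumberTheory.Automorphic.UnitaryGroupBorelInduction   -- ★ `UnitaryGroup.torusU`, `mem_torusU_iff`, `borelTriple_M`, `StdForm.antidiagonal`
import Literature.NumberTheory.Rogawski1990.LocalTransfer                -- ★ `IsRegularElt` (:228), `isRegularElt_conj_iff`
import HarnessLib

/-!
# F0 · P3c · line LH6 «StCharTS» — «WEYL-HYP★» STAGE (A2): THE NORMALISER OF THE SPLIT TORUS, `N(T) = T ⊔ w·T`, IN `U(σ, Φ₃)(R)` OVER A FIELD-LIKE `R`
# (sibling of `F0P3cStCharTSWeylHypFibre`: (A0)(A1)(A3)) [Rogawski1990 §12.5 p. 182; vanDijk1972 §2; Springer 7.1.5]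

Cell `pub/hodgecm-mathlib`, crux H413 = `stmt-HodgeConjecture-24833` (`--supports` lane, helper), route HCCMUnconditional; seat LH2-p01 (g3), deal «WEYL-HYP★ — stage (A)»
of F0P3b-plan (g23) 2026-09-02T05:26:46Z (desk heir F0P3-plan (g14) 05:26:18Z routing).  THEOREMS ONLY, sorry-free, no definition ∕ instance ∕ notation ∕ named fact.
PURPOSE.  Every in-house discharge of the split-torus inputs (WM)∕(HM)∕(PSM) of the LH6 leaf («`tr σ(φ) = ∫_M F_φ Θ_σ` for `φ` supported in the hyperbolic set `Ω`») runs
through the WEYL INTEGRATION FORMULA ON THE HYPERBOLIC SET of `G = U(Φ₃)(L⁺_v)` w.r.t. the split torus `M = (cmBorelTriple L 3 v).M = torusU σ J` (★ `borelTriple_M`,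
`rfl`).  Stage (A) is its group theory; stage (B) (the measure identity `∫_Ω φ = ½ ∫_{M^{reg}} |D(m)| ∫_{G∕M} φ(g m g⁻¹)`) is a later brick.

THE CARRIER is kept GENERIC: `U := ↥(unitaryGroupOfForm σ J)` over ANY commutative ring `R` with ANY endomorphism `σ` and form `J` (so the CM local carrier
`(cmDatum L N Φ_N).Local v = ↥(unitaryGroupOfForm (conjLocal L c v) (cmLocalForm L N v))`, ★ `cmDatum_Local_eq`, is an instance ON THE NOSE), `T := torusU σ J` the diagonal
torus (★ `UnitaryGroupBorelInduction` :115).  REGULARITY of a diagonal `m = diag(d)` is used in the convenient form «UNIT DIFFERENCES» `∀ i ≠ j, IsUnit (dᵢ − dⱼ)`; the link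
from the tree's `IsRegularElt` (separable characteristic polynomial, ★ `LocalTransfer` :228) is `isUnit_sub_of_isRegularElt_glDiagonal`.

* (A2) **`mem_normalizer_torusU_antidiag_three_iff`** — at `N = 3`, `J = Φ₃ = (StdForm.antidiagonal 3).over R`, over a FIELD-LIKE nontrivial `R` (`x ≠ 0 → IsUnit x`:
  the local FIELD `E_w` at a NON-SPLIT place through ★ `localNonsplitEquiv`; at a split place the statement is false — the Weyl group of the diagonal torus of `GL₃` is
  `S₃`) whose diagonal torus has ONE regular element (`IsRegularElt`): `g ∈ N(T) ↔` the matrix of `g` is DIAGONAL or ANTI-DIAGONAL — i.e. `N(T) = T ⊔ w·T` with `w` the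
  antidiagonal Weyl element (`antidiagOne_mem_unitaryGroupOfForm`: the unit with matrix `Φ₃` lies in `U(σ, Φ₃)`), `|N(T)∕T| = 2`.  Road: conjugating the regular
  `m = diag(d)` by `g ∈ N(T)` gives a diagonal `m′ = g⁻¹ m g = diag(d′)` with `g_{ij}(d′_j − d_i) = 0` and `d, d′` with unit differences, so every row and column of `g`
  has exactly one non-zero entry; unitarity at the entry `(1,1)` of `ᵗ(σg) Φ₃ g = Φ₃` forces `g₁₁ ≠ 0`, leaving the identity and the transposition `0 ↔ 2`.
  `antidiagonal_over_apply` spells the entries of `Φ₃`.  (The (A0)∕(A0′) plumbing of the sibling file is re-proved PRIVATELY here so the two files land independently.)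
NOT HERE (honest census): (A4) «`Ω = ⋃_g g T^{reg} g⁻¹` is OPEN» needs a `p`-adic submersion ∕ inverse-function input the tree does not hold — it is stage (B)'s first
hypothesis; nothing in this file is measure-theoretic.
HONEST LABEL: HC_CM is proved only modulo the 7 printed citations (2 remaining: hLiu418 = `stmt-HodgeConjecture-24832`, h413 = `stmt-HodgeConjecture-24833`) until rung 0
closes; this file is count-neutral group theory for the (WM)∕(HM) road and closes no organ.

## References
* [Rogawski1990] J. D. Rogawski, *Automorphic Representations of Unitary Groups in Three Variables*, Ann. of Math. Stud. 123 (1990), §12.5 p. 182 (Weyl integration on the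
  split torus), §1.10 p. 9 (`B = MN`, `M` the diagonal subgroup), §3.1 p. 19 (regular elements).
* [vanDijk1972] G. van Dijk, *Computation of certain induced characters of `p`-adic groups*, Math. Ann. 199 (1972), §2 (Weyl integration formula on `G^{reg}`).
* [SpringerLAG1998] T. A. Springer, *Linear Algebraic Groups*, 2nd ed. (1998), 8.1.12 (3) (centralisers of semisimple elements), 7.1.5 (normaliser of a maximal torus).
-/

set_option autoImplicit false
set_option linter.dupNamespace false

open Matrix Polynomial
open Literature.NumberTheory.Automorphic Literature.NumberTheory.Automorphic.UnitaryGroup Literature.NumberTheory.Rogawski1990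
open scoped MatrixGroups

namespace Summit.HodgeConjecture.HodgeConjecture.Cruxes.H413.F0P3cStCharTSWeylHypNormaliser

/-! ## §0 Private plumbing (= (A0), (A0′) of the sibling file) -/

section Plumbing

variable {R : Type*} [CommRing R] (σ : R →+* R) {N : ℕ} (J : Matrix (Fin N) (Fin N) R)

/-- `g ∈ T ↔ g` is diagonal (sibling (A0)). [cite: Rogawski1990, §1.10 p. 9] -/
private theorem mem_torusU_iff_forall_apply_eq_zero' (g : ↥(unitaryGroupOfForm σ J)) :
    g ∈ torusU σ J ↔ ∀ i j : Fin N, i ≠ j → ((g : GL (Fin N) R) : Matrix (Fin N) (Fin N) R) i j = 0 := by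
  constructor
  · rintro ⟨d, hd⟩ i j hij
    have h := congrArg (fun x : GL (Fin N) R => (x : Matrix (Fin N) (Fin N) R) i j) hd
    simp only [coe_glDiagonal, diagonal_apply_ne _ hij] at h
    exact h.symm
  · intro h
    set G : Matrix (Fin N) (Fin N) R := ((g : GL (Fin N) R) : Matrix (Fin N) (Fin N) R) with hG
    set G' : Matrix (Fin N) (Fin N) R := (((g : GL (Fin N) R)⁻¹ : GL (Fin N) R) : Matrix (Fin N) (Fin N) R) with hG'
    have hGG' : G * G' = 1 := by rw [hG, hG', ← Units.val_mul, mul_inv_cancel, Units.val_one]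
    have hG'G : G' * G = 1 := by rw [hG, hG', ← Units.val_mul, inv_mul_cancel, Units.val_one]
    have h1 : ∀ i, G i i * G' i i = 1 := by
      intro i
      have e := congrFun (congrFun hGG' i) i
      rw [Matrix.mul_apply, Finset.sum_eq_single i (fun k _ hk => by rw [h i k (Ne.symm hk), zero_mul]) (fun hi => absurd (Finset.mem_univ i) hi),
        Matrix.one_apply_eq] at e
      exact e
    have h2 : ∀ i, G' i i * G i i = 1 := by
      intro i
      have e := congrFun (congrFun hG'G i) i
      rw [Matrix.mul_apply, Finset.sum_eq_single i (fun k _ hk => by rw [h k i hk, mul_zero]) (fun hi => absurd (Finset.mem_univ i) hi),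
        Matrix.one_apply_eq] at e
      exact e
    refine ⟨fun i => ⟨G i i, G' i i, h1 i, h2 i⟩, Units.ext ?_⟩
    rw [coe_glDiagonal, Subgroup.coe_subtype]
    ext i j
    by_cases hij : i = j
    · subst hij; rw [diagonal_apply_eq]
    · rw [diagonal_apply_ne _ hij]; exact (h i j hij).symm

/-- `IsRegularElt (diag d)` ⇒ unit differences (sibling (A0′)). [cite: Rogawski1990, §3.1 p. 19] -/
private theorem isUnit_sub_of_isRegularElt_glDiagonal' {d : Fin N → Rˣ} (h : IsRegularElt (glDiagonal N R d)) {i j : Fin N} (hij : i ≠ j) :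
    IsUnit ((d i : R) - d j) := by
  rw [IsRegularElt, coe_glDiagonal, Matrix.charpoly_diagonal] at h
  have hdvd : (X - C (d i : R)) * (X - C (d j : R)) ∣ ∏ k, (X - C (d k : R)) := by
    rw [← Finset.mul_prod_erase Finset.univ (fun k => X - C (d k : R)) (Finset.mem_univ i)]
    exact mul_dvd_mul_left _ (Finset.dvd_prod_of_mem (fun k => X - C (d k : R)) (Finset.mem_erase.2 ⟨hij.symm, Finset.mem_univ j⟩))
  obtain ⟨u, v, huv⟩ := (h.of_dvd hdvd).isCoprime
  have e := congrArg (Polynomial.eval (d i : R)) huv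
  simp only [eval_add, eval_mul, eval_sub, eval_X, eval_C, sub_self, mul_zero, zero_add, eval_one] at e
  exact IsUnit.of_mul_eq_one _ (by rwa [mul_comm] at e)

end Plumbing

/-! ## §4 (A2) The normaliser of the diagonal torus of `U(σ, Φ₃)(R)`, `R` field-like: `N(T) = T ⊔ w·T` -/

section Normaliser

variable {R : Type*} [CommRing R] (σ : R →+* R)

/-- Entries of `Φ₃ = (StdForm.antidiagonal 3).over R`: `1` on the anti-diagonal, `0` elsewhere. [cite: Rogawski1990, §1.9 p. 8] -/
theorem antidiagonal_over_apply (i j : Fin 3) : ((StdForm.antidiagonal 3).over R) i j = if j = i.rev then (1 : R) else 0 := by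
  rw [StdForm.over, Matrix.map_apply, StdForm.antidiagonal_J_apply]
  split_ifs <;> simp

/-- **The antidiagonal Weyl element**: the unit with matrix `Φ₃` (its own inverse, `Φ₃² = 1`) lies in `U(σ, Φ₃)(R)` — it is the `w` of `N(T) = T ⊔ w·T`.
[cite: Rogawski1990, §12.5 p. 182; §1.10 p. 9] -/
theorem antidiagOne_mem_unitaryGroupOfForm {J : Matrix (Fin 3) (Fin 3) R} (hJ : J = (StdForm.antidiagonal 3).over R) :
    (⟨J, J, by rw [hJ, StdForm.over_mul_over], by rw [hJ, StdForm.over_mul_over]⟩ : GL (Fin 3) R) ∈ unitaryGroupOfForm σ J := by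
  rw [mem_unitaryGroupOfForm_iff]
  show (J.map σ)ᵀ * J * J = J
  have hmap : J.map σ = J := by
    rw [hJ]; ext i j; rw [Matrix.map_apply, antidiagonal_over_apply]; split_ifs <;> simp
  rw [hmap, hJ, StdForm.transpose_over, Matrix.mul_assoc, StdForm.over_mul_over, Matrix.mul_one]

/-- **(A2) `N_U(T) = T ⊔ w·T` for `U = U(σ, Φ₃)(R)` over a field-like nontrivial `R` (every non-zero element a unit — the local FIELD `E_w` at a non-split place) whose
diagonal torus has a REGULAR element**: `g` normalises `T = torusU σ Φ₃` iff its matrix is DIAGONAL (`g ∈ T`) or ANTI-DIAGONAL (`g ∈ w·T`).  (⇒) conjugating the regular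
`m = diag(d)` by `g` gives a diagonal `m′ = g⁻¹ m g = diag(d′)` with `g_{ij}(d′_j − d_i) = 0`, `d, d′` with unit differences, so every row and every column of `g` has exactly
one non-zero entry; unitarity at the entry `(1,1)` of `ᵗ(σg) Φ₃ g = Φ₃` forces `g₁₁ ≠ 0`, leaving the identity and the transposition `0 ↔ 2`.  (⇐) diagonal and
anti-diagonal monomial matrices conjugate diagonal matrices to diagonal matrices.  At a SPLIT place (`R = L_w × L_{w̄}`, `U ≅ GL₃`) the statement is false (`W = S₃`): the
field-like hypothesis is essential. [cite: Rogawski1990, §12.5 p. 182] [cite: SpringerLAG1998, 7.1.5] [cite: vanDijk1972, §2] -/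
theorem mem_normalizer_torusU_antidiag_three_iff [Nontrivial R] (hR : ∀ x : R, x ≠ 0 → IsUnit x)
    {J : Matrix (Fin 3) (Fin 3) R} (hJ : J = (StdForm.antidiagonal 3).over R)
    (hex : ∃ m : ↥(unitaryGroupOfForm σ J), m ∈ torusU σ J ∧ IsRegularElt (m : GL (Fin 3) R))
    (g : ↥(unitaryGroupOfForm σ J)) :
    g ∈ Subgroup.normalizer (torusU σ J : Set ↥(unitaryGroupOfForm σ J)) ↔
      (∀ i j : Fin 3, i ≠ j → ((g : GL (Fin 3) R) : Matrix (Fin 3) (Fin 3) R) i j = 0) ∨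
        (∀ i j : Fin 3, j ≠ i.rev → ((g : GL (Fin 3) R) : Matrix (Fin 3) (Fin 3) R) i j = 0) := by
  set G : Matrix (Fin 3) (Fin 3) R := ((g : GL (Fin 3) R) : Matrix (Fin 3) (Fin 3) R) with hG
  set G' : Matrix (Fin 3) (Fin 3) R := (((g : GL (Fin 3) R)⁻¹ : GL (Fin 3) R) : Matrix (Fin 3) (Fin 3) R) with hG'
  have hGG' : G * G' = 1 := by rw [hG, hG', ← Units.val_mul, mul_inv_cancel, Units.val_one]
  have hG'G : G' * G = 1 := by rw [hG, hG', ← Units.val_mul, inv_mul_cancel, Units.val_one]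
  have hrev0 : (0 : Fin 3).rev = 2 := rfl
  have hrev1 : (1 : Fin 3).rev = 1 := rfl
  have hrev2 : (2 : Fin 3).rev = 0 := rfl
  constructor
  · intro hg
    -- the regular diagonal element and its conjugate
    obtain ⟨m, hmT, hmreg⟩ := hex
    obtain ⟨d, hd⟩ := hmT
    have hd' : glDiagonal 3 R d = (m : GL (Fin 3) R) := by rw [hd, Subgroup.coe_subtype]
    have hm'T : g⁻¹ * m * g ∈ torusU σ J := by
      have h := (Subgroup.mem_normalizer_iff''.1 hg m).1 ⟨d, hd⟩
      exact h
    obtain ⟨d', hdd'⟩ := hm'T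
    have hd'' : glDiagonal 3 R d' = ((g⁻¹ * m * g : ↥(unitaryGroupOfForm σ J)) : GL (Fin 3) R) := by rw [hdd', Subgroup.coe_subtype]
    -- unit differences for `d` and `d′`
    have hregd : ∀ i j : Fin 3, i ≠ j → IsUnit ((d i : R) - d j) := fun i j hij =>
      isUnit_sub_of_isRegularElt_glDiagonal' (by rw [hd']; exact hmreg) hij
    have hregd' : ∀ i j : Fin 3, i ≠ j → IsUnit ((d' i : R) - d' j) := fun i j hij => by
      refine isUnit_sub_of_isRegularElt_glDiagonal' ?_ hij
      rw [hd'', Subgroup.coe_mul, Subgroup.coe_mul, Subgroup.coe_inv]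
      have e : ((g : GL (Fin 3) R))⁻¹ * (m : GL (Fin 3) R) * (g : GL (Fin 3) R) =
          ((g : GL (Fin 3) R))⁻¹ * (m : GL (Fin 3) R) * (((g : GL (Fin 3) R))⁻¹)⁻¹ := by rw [inv_inv]
      rw [e, isRegularElt_conj_iff]
      exact hmreg
    -- the relation `G D′ = D G`
    have hmat : ((m : GL (Fin 3) R) : Matrix (Fin 3) (Fin 3) R) = diagonal fun k => (d k : R) := by rw [← hd', coe_glDiagonal]
    have hmat' : G' * (diagonal fun k => (d k : R)) * G = diagonal fun k => (d' k : R) := by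
      have h := congrArg (fun x : GL (Fin 3) R => (x : Matrix (Fin 3) (Fin 3) R)) hd''
      rw [coe_glDiagonal, Subgroup.coe_mul, Subgroup.coe_mul, Subgroup.coe_inv, Units.val_mul, Units.val_mul, hmat] at h
      exact h.symm
    have hrel : G * (diagonal fun k => (d' k : R)) = (diagonal fun k => (d k : R)) * G := by
      rw [← hmat', ← Matrix.mul_assoc, ← Matrix.mul_assoc, hGG', Matrix.one_mul]
    have key : ∀ i j : Fin 3, G i j ≠ 0 → (d i : R) = d' j := by
      intro i j hij
      have e := congrFun (congrFun hrel i) j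
      rw [mul_diagonal, diagonal_mul] at e
      have e2 : G i j * ((d' j : R) - d i) = 0 := by rw [mul_sub, e]; ring
      have hu := hR _ hij
      exact (sub_eq_zero.1 ((hu.mul_right_eq_zero).1 e2)).symm
    have rowuniq : ∀ i j k : Fin 3, G i j ≠ 0 → G i k ≠ 0 → j = k := by
      intro i j k hj hk
      by_contra hjk
      have h1 := key i j hj
      have h2 := key i k hk
      have hu := hregd' j k hjk
      rw [← h1, ← h2, sub_self] at hu
      exact not_isUnit_zero hu
    have coluniq : ∀ i i' j : Fin 3, G i j ≠ 0 → G i' j ≠ 0 → i = i' := by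
      intro i i' j hi hi'
      by_contra hii
      have h1 := key i j hi
      have h2 := key i' j hi'
      have hu := hregd i i' hii
      rw [h1, h2, sub_self] at hu
      exact not_isUnit_zero hu
    have rowex : ∀ i : Fin 3, ∃ j, G i j ≠ 0 := by
      intro i
      by_contra h
      push Not at h
      have e := congrFun (congrFun hGG' i) i
      rw [Matrix.mul_apply, Matrix.one_apply_eq] at e
      rw [Finset.sum_eq_zero (fun k _ => by rw [h k, zero_mul])] at e
      exact zero_ne_one e
    -- unitarity at the entry `(1,1)`: `σ(G₀₁) G₂₁ + σ(G₁₁) G₁₁ + σ(G₂₁) G₀₁ = 1`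
    have hmem : (G.map σ)ᵀ * J * G = J := g.2
    have h11 : σ (G 2 1) * G 0 1 + σ (G 1 1) * G 1 1 + σ (G 0 1) * G 2 1 = 1 := by
      have e := congrFun (congrFun hmem 1) 1
      rw [hJ] at e
      simp only [Matrix.mul_apply, Fin.sum_univ_three, transpose_apply, map_apply, antidiagonal_over_apply, hrev0, hrev1, hrev2] at e
      simpa using e
    have hG11 : G 1 1 ≠ 0 := by
      intro h0
      by_cases h01 : G 0 1 = 0
      · rw [h0, h01, map_zero, mul_zero, mul_zero, zero_mul] at h11
        norm_num at h11
      · by_cases h21 : G 2 1 = 0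
        · rw [h0, h21, map_zero, zero_mul, mul_zero, mul_zero] at h11
          norm_num at h11
        · exact absurd (coluniq 0 2 1 h01 h21) (by decide)
    have hG10 : G 1 0 = 0 := by by_contra h; exact absurd (rowuniq 1 1 0 hG11 h) (by decide)
    have hG12 : G 1 2 = 0 := by by_contra h; exact absurd (rowuniq 1 1 2 hG11 h) (by decide)
    have hG01 : G 0 1 = 0 := by by_contra h; exact absurd (coluniq 1 0 1 hG11 h) (by decide)
    have hG21 : G 2 1 = 0 := by by_contra h; exact absurd (coluniq 1 2 1 hG11 h) (by decide)
    by_cases hG00 : G 0 0 = 0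
    · -- anti-diagonal
      right
      have hG02 : G 0 2 ≠ 0 := by
        obtain ⟨j, hj⟩ := rowex 0
        fin_cases j
        · exact absurd hG00 hj
        · exact absurd hG01 hj
        · exact hj
      have hG22 : G 2 2 = 0 := by by_contra h; exact absurd (coluniq 0 2 2 hG02 h) (by decide)
      intro i j hij
      fin_cases i <;> fin_cases j
      · exact hG00
      · exact hG01
      · exact absurd hrev0.symm hij
      · exact hG10
      · exact absurd hrev1.symm hij
      · exact hG12
      · exact absurd hrev2.symm hij
      · exact hG21
      · exact hG22
    · -- diagonal
      left
      have hG02 : G 0 2 = 0 := by by_contra h; exact absurd (rowuniq 0 0 2 hG00 h) (by decide)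
      have hG20 : G 2 0 = 0 := by by_contra h; exact absurd (coluniq 0 2 0 hG00 h) (by decide)
      intro i j hij
      fin_cases i <;> fin_cases j
      · exact absurd rfl hij
      · exact hG01
      · exact hG02
      · exact hG10
      · exact absurd rfl hij
      · exact hG12
      · exact hG20
      · exact hG21
      · exact absurd rfl hij
  · -- (⇐)
    rintro (hdiag | hanti)
    · exact Subgroup.le_normalizer ((mem_torusU_iff_forall_apply_eq_zero' σ J g).2 hdiag)
    · -- `g` anti-diagonal: its inverse is anti-diagonal too, and `g t g⁻¹` is diagonal for diagonal `t`
      have hz : ∀ i j : Fin 3, j ≠ i.rev → G i j = 0 := hanti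
      have hG00 : G 0 0 = 0 := hz 0 0 (by decide)
      have hG01 : G 0 1 = 0 := hz 0 1 (by decide)
      have hG10 : G 1 0 = 0 := hz 1 0 (by decide)
      have hG12 : G 1 2 = 0 := hz 1 2 (by decide)
      have hG21 : G 2 1 = 0 := hz 2 1 (by decide)
      have hG22 : G 2 2 = 0 := hz 2 2 (by decide)
      -- the anti-diagonal entries of `G` are units, and `G′` is anti-diagonal
      have hu02 : IsUnit (G 0 2) := by
        have e := congrFun (congrFun hGG' 0) 0
        simp only [Matrix.mul_apply, Fin.sum_univ_three, Matrix.one_apply_eq, hG00, hG01, zero_mul, zero_add] at e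
        exact IsUnit.of_mul_eq_one _ e
      have hu11 : IsUnit (G 1 1) := by
        have e := congrFun (congrFun hGG' 1) 1
        simp only [Matrix.mul_apply, Fin.sum_univ_three, Matrix.one_apply_eq, hG10, hG12, zero_mul, zero_add, add_zero] at e
        exact IsUnit.of_mul_eq_one _ e
      have hu20 : IsUnit (G 2 0) := by
        have e := congrFun (congrFun hGG' 2) 2
        simp only [Matrix.mul_apply, Fin.sum_univ_three, Matrix.one_apply_eq, hG21, hG22, zero_mul, add_zero] at e
        exact IsUnit.of_mul_eq_one _ e
      have hr0 : ∀ b : Fin 3, b ≠ 0 → G' 2 b = 0 := by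
        intro b hb
        have e := congrFun (congrFun hGG' 0) b
        rw [Matrix.one_apply_ne (Ne.symm hb)] at e
        simp only [Matrix.mul_apply, Fin.sum_univ_three, hG00, hG01, zero_mul, zero_add] at e
        exact (hu02.mul_right_eq_zero).1 e
      have hr1 : ∀ b : Fin 3, b ≠ 1 → G' 1 b = 0 := by
        intro b hb
        have e := congrFun (congrFun hGG' 1) b
        rw [Matrix.one_apply_ne (Ne.symm hb)] at e
        simp only [Matrix.mul_apply, Fin.sum_univ_three, hG10, hG12, zero_mul, zero_add, add_zero] at e
        exact (hu11.mul_right_eq_zero).1 e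
      have hr2 : ∀ b : Fin 3, b ≠ 2 → G' 0 b = 0 := by
        intro b hb
        have e := congrFun (congrFun hGG' 2) b
        rw [Matrix.one_apply_ne (Ne.symm hb)] at e
        simp only [Matrix.mul_apply, Fin.sum_univ_three, hG21, hG22, zero_mul, add_zero] at e
        exact (hu20.mul_right_eq_zero).1 e
      have hG'00 : G' 0 0 = 0 := hr2 0 (by decide)
      have hG'01 : G' 0 1 = 0 := hr2 1 (by decide)
      have hG'10 : G' 1 0 = 0 := hr1 0 (by decide)
      have hG'12 : G' 1 2 = 0 := hr1 2 (by decide)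
      have hG'21 : G' 2 1 = 0 := hr0 1 (by decide)
      have hG'22 : G' 2 2 = 0 := hr0 2 (by decide)
      rw [Subgroup.mem_normalizer_iff]
      intro t
      constructor
      · rintro ⟨e, he⟩
        have hte : ((t : GL (Fin 3) R) : Matrix (Fin 3) (Fin 3) R) = diagonal fun k => (e k : R) := by
          rw [← coe_glDiagonal, he, Subgroup.coe_subtype]
        refine (mem_torusU_iff_forall_apply_eq_zero' σ J _).2 fun i j hij => ?_
        show (((g * t * g⁻¹ : ↥(unitaryGroupOfForm σ J)) : GL (Fin 3) R) : Matrix (Fin 3) (Fin 3) R) i j = 0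
        rw [Subgroup.coe_mul, Subgroup.coe_mul, Subgroup.coe_inv, Units.val_mul, Units.val_mul, hte]
        change (G * (diagonal fun k => (e k : R)) * G') i j = 0
        fin_cases i <;> fin_cases j
        all_goals first
          | exact absurd rfl hij
          | simp [Matrix.mul_apply, Fin.sum_univ_three, diagonal, hG00, hG01, hG10, hG12, hG21, hG22, hG'00, hG'01, hG'10, hG'12, hG'21, hG'22]
      · intro hconj
        -- `t = g⁻¹ (g t g⁻¹) g` with `g t g⁻¹` diagonal
        obtain ⟨e, he⟩ := hconj
        have hce : (((g * t * g⁻¹ : ↥(unitaryGroupOfForm σ J)) : GL (Fin 3) R) : Matrix (Fin 3) (Fin 3) R) = diagonal fun k => (e k : R) := by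
          rw [← coe_glDiagonal, he, Subgroup.coe_subtype]
        have hte : ((t : GL (Fin 3) R) : Matrix (Fin 3) (Fin 3) R) = G' * (diagonal fun k => (e k : R)) * G := by
          have e1 : t = g⁻¹ * (g * t * g⁻¹) * g := by group
          have e2 := congrArg (fun x : ↥(unitaryGroupOfForm σ J) => ((x : GL (Fin 3) R) : Matrix (Fin 3) (Fin 3) R)) e1
          rw [e2, Subgroup.coe_mul, Subgroup.coe_mul, Subgroup.coe_inv, Units.val_mul, Units.val_mul, hce]
        refine (mem_torusU_iff_forall_apply_eq_zero' σ J t).2 fun i j hij => ?_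
        rw [hte]
        fin_cases i <;> fin_cases j
        all_goals first
          | exact absurd rfl hij
          | simp [Matrix.mul_apply, Fin.sum_univ_three, diagonal, hG00, hG01, hG10, hG12, hG21, hG22, hG'00, hG'01, hG'10, hG'12, hG'21, hG'22]

end Normaliser

end Summit.HodgeConjecture.HodgeConjecture.Cruxes.H413.F0P3cStCharTSWeylHypNormaliser
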